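import Summits.BirchSwinnertonDyer.BirchSwinnertonDyer.Theorems.ClassRecordThreeEulerHalvesAtThreeCartanSupplyTorusLines
import HarnessLib

/-!
# SUPPLY from PERMUTATION MODELS, VII — the TRACE IDENTITY from two CONVOLUTION IDENTITIES, over `ℤ`

Helper file riding `--supports stmt-BirchSwinnertonDyer-19109` (crux `EulerHalvesAtThree`; UNREGISTERED sub-line `Cruxes/EulerHalvesAtThree/Lines/cartan_corr`,
seat `bsd-idea-10` g12), continuing `…CartanSupplyPermModel ∕ … ∕ TorusLines`. CHARACTER-FREE PACKAGING of the one remaining input of SUPPLY, the trace identity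
`tr(g | ker A_χ) = χ(g)` (`A_χ = χ(1)·M − N`, `M = Σ_h χ(h)·h`, `N = #G`) on a permutation lattice `ℤ^n`: it FOLLOWS from the two convolution identities of explicit
class functions (α) `χ(1)·Σ_h χ(h)·χ(h⁻¹k) = N·χ(k)` («`χ ∗ χ = (N∕χ(1))·χ`», i.e. `e = (χ(1)∕N)·M` is idempotent) and (β) `χ(1)·Σ_h χ(h)·#Fix(gh) = N·χ(g)` («`χ ∗ π = (N∕χ(1))·χ`»,
`π` the permutation character) — ENTIRELY OVER `ℤ`, no `⊗ℚ`: with `Q = χ(1)·M : ℤ^n → K = ker A_χ` (well-defined by (α)) and `ι : K ↪ ℤ^n`, `Q ∘ ι = N·id_K` and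
`ι ∘ g|_K ∘ Q = χ(1)·g∘M`, so `LinearMap.trace_comp_comm'` gives `N·tr(g | K) = χ(1)·Σ_h χ(h)·tr(gh | ℤ^n) = χ(1)·Σ_h χ(h)·#Fix(gh)` (`trace_permAct`) `= N·χ(g)`
(`trace_eq_of_convolution`). NET: `CartanConvolutionSupply` — per prime `q ∉ {2,3}`: (α) for `χ_W` on `GL₂(𝔽_q)` and (β) for `χ_W` against the coset space `G ∕ T_s`
(`q ≡ 1 (3)`) ∕ `G ∕ C(η)` for some elliptic `η` (`q ≡ 2 (3)`); `cartanTorusLatticeSupply_of_convolutionSupply : CartanConvolutionSupply → CartanTorusLatticeSupply`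
(SUPPLY, the v11 stub of 23422's line `cartan`, BY NAME). For an irreducible character both identities are the standard orthogonality relations plus «`W_q` once in
`ℚ[G ∕ T]`»; as typed they are finite sums over `GL₂(𝔽_q)` with no representation theory in the statement. HONEST FRAMING: reductions and linear algebra only; (α), (β),
SUPPLY, NUM, (F2b♭), the cruxes are NOT proved; BSD is proved for no curve. [folklore]
-/

set_option linter.dupNamespace false
set_option autoImplicit false

namespace Summit.BirchSwinnertonDyer.BirchSwinnertonDyer.Theorems.CartanSupply

open Summit.BirchSwinnertonDyer.BirchSwinnertonDyer.Theorems.CartanDegree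
open Summit.BirchSwinnertonDyer.BirchSwinnertonDyer.Theorems.CartanTorusCubeCut
open Summit.BirchSwinnertonDyer.BirchSwinnertonDyer.Theorems.CartanCorrespondence

/-! ## §1 Generic: trace of a permutation; the trace identity from (α), (β) -/

section general
variable {G : Type*} [Group G] [Fintype G] {n : ℕ} (σ : G →* Equiv.Perm (Fin n))

omit [Fintype G] in
/-- PROVED: the trace of a permutation operator is its number of fixed points. [folklore] -/
theorem trace_permAct (g : G) :
    LinearMap.trace ℤ (Fin n → ℤ) (permAct σ g) = ((Finset.univ.filter fun i : Fin n => σ g i = i).card : ℤ) := by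
  rw [LinearMap.trace_eq_matrix_trace ℤ (Pi.basisFun ℤ (Fin n))]
  have h : ∀ i : Fin n, LinearMap.toMatrix (Pi.basisFun ℤ (Fin n)) (Pi.basisFun ℤ (Fin n)) (permAct σ g) i i = if σ g i = i then 1 else 0 := by
    intro i
    rw [LinearMap.toMatrix_apply, Pi.basisFun_repr, Pi.basisFun_apply]
    show (Pi.single i (1 : ℤ) : Fin n → ℤ) ((σ g)⁻¹ i) = _
    by_cases hi : σ g i = i
    · have h' : (σ g)⁻¹ i = i := by rw [Equiv.Perm.inv_eq_iff_eq]; exact hi.symm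
      rw [if_pos hi, h', Pi.single_eq_same]
    · rw [if_neg hi, Pi.single_eq_of_ne]
      intro h'
      exact hi (Equiv.Perm.inv_eq_iff_eq.mp h').symm
  simp only [Matrix.trace, Matrix.diag_apply, h, Finset.sum_boole]

/-- PROVED: the operator form of (α): `χ(1)·M(Mv) = N·Mv`. [folklore] -/
theorem classSumOp_classSumOp (χ : G → ℤ) (hα : ∀ k : G, χ 1 * ∑ h, χ h * χ (h⁻¹ * k) = Fintype.card G * χ k) (v : Fin n → ℤ) :
    χ 1 • classSumOp σ χ (classSumOp σ χ v) = (Fintype.card G : ℤ) • classSumOp σ χ v := by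
  rw [classSumOp_apply, classSumOp_apply]
  have h1 : ∀ g : G, permAct σ g (∑ h, χ h • permAct σ h v) = ∑ h, χ h • permAct σ (g * h) v := by
    intro g
    rw [map_sum]
    exact Finset.sum_congr rfl (fun h _ => by rw [map_smul, map_mul, Module.End.mul_apply])
  have h2 : ∀ g : G, (∑ h, χ h • permAct σ (g * h) v) = ∑ k, χ (g⁻¹ * k) • permAct σ k v := by
    intro g
    exact Fintype.sum_equiv (Equiv.mulLeft g) _ _ (fun h => by simp only [Equiv.coe_mulLeft, inv_mul_cancel_left])
  simp only [h1, h2, Finset.smul_sum, smul_smul]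
  rw [Finset.sum_comm]
  simp only [← Finset.sum_smul]
  exact Finset.sum_congr rfl (fun k _ => by rw [← Finset.mul_sum, hα k])

/-- PROVED — THE TRACE IDENTITY FROM (α), (β), over `ℤ`. [folklore] -/
theorem trace_eq_of_convolution (χ : G → ℤ)
    (hst : ∀ g, ∀ φ ∈ LinearMap.ker (isotypicOp σ χ), permAct σ g φ ∈ LinearMap.ker (isotypicOp σ χ))
    (hα : ∀ k : G, χ 1 * ∑ h, χ h * χ (h⁻¹ * k) = Fintype.card G * χ k)
    (hβ : ∀ g : G, χ 1 * ∑ h, χ h * ((Finset.univ.filter fun i : Fin n => σ (g * h) i = i).card : ℤ) = Fintype.card G * χ g) (g : G) :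
    LinearMap.trace ℤ (LinearMap.ker (isotypicOp σ χ)) ((permAct σ g).restrict (hst g)) = χ g := by
  obtain ⟨dK, bK⟩ := Submodule.basisOfPid (Pi.basisFun ℤ (Fin n)) (LinearMap.ker (isotypicOp σ χ))
  haveI := Module.Free.of_basis bK
  haveI := Module.Finite.of_basis bK
  -- `Q = χ(1)·M` lands in `K`
  have hQmem : ∀ v : Fin n → ℤ, (χ 1 • classSumOp σ χ) v ∈ LinearMap.ker (isotypicOp σ χ) := by
    intro v
    rw [LinearMap.mem_ker, LinearMap.smul_apply, map_smul, isotypicOp_apply, classSumOp_classSumOp σ χ hα, sub_self, smul_zero]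
  let Q : (Fin n → ℤ) →ₗ[ℤ] LinearMap.ker (isotypicOp σ χ) := LinearMap.codRestrict _ (χ 1 • classSumOp σ χ) hQmem
  let ι : LinearMap.ker (isotypicOp σ χ) →ₗ[ℤ] (Fin n → ℤ) := (LinearMap.ker (isotypicOp σ χ)).subtype
  -- `Q ∘ ι = N·id`
  have hQι : Q ∘ₗ ι = (Fintype.card G : ℤ) • LinearMap.id := by
    apply LinearMap.ext
    intro x
    apply Subtype.ext
    have hx : isotypicOp σ χ (x : Fin n → ℤ) = 0 := LinearMap.mem_ker.mp x.2
    rw [isotypicOp_apply, sub_eq_zero] at hx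
    rw [LinearMap.comp_apply, LinearMap.codRestrict_apply, Submodule.subtype_apply, LinearMap.smul_apply, hx]
    rfl
  -- `ι ∘ g|_K ∘ Q = χ(1)·(g ∘ M)`
  have hcomp : ι ∘ₗ (((permAct σ g).restrict (hst g)) ∘ₗ Q) = χ 1 • (permAct σ g ∘ₗ classSumOp σ χ) := by
    apply LinearMap.ext
    intro v
    rw [LinearMap.comp_apply, LinearMap.comp_apply, Submodule.subtype_apply, LinearMap.coe_restrict_apply, LinearMap.codRestrict_apply,
      LinearMap.smul_apply, LinearMap.smul_apply, LinearMap.comp_apply, map_smul]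
  -- traces
  have hT1 : LinearMap.trace ℤ (Fin n → ℤ) (ι ∘ₗ (((permAct σ g).restrict (hst g)) ∘ₗ Q)) =
      (Fintype.card G : ℤ) * LinearMap.trace ℤ (LinearMap.ker (isotypicOp σ χ)) ((permAct σ g).restrict (hst g)) := by
    rw [LinearMap.trace_comp_comm', LinearMap.comp_assoc, hQι, LinearMap.comp_smul, LinearMap.comp_id, map_smul, smul_eq_mul]
  have hgM : permAct σ g ∘ₗ classSumOp σ χ = ∑ h, χ h • permAct σ (g * h) := by
    apply LinearMap.ext
    intro v
    rw [LinearMap.comp_apply, classSumOp_apply, map_sum, LinearMap.sum_apply]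
    exact Finset.sum_congr rfl (fun h _ => by rw [map_smul, LinearMap.smul_apply, map_mul, Module.End.mul_apply])
  have hT2 : LinearMap.trace ℤ (Fin n → ℤ) (χ 1 • (permAct σ g ∘ₗ classSumOp σ χ)) = Fintype.card G * χ g := by
    rw [map_smul, smul_eq_mul, hgM, map_sum, ← hβ g]
    congr 1
    exact Finset.sum_congr rfl (fun h _ => by rw [map_smul, smul_eq_mul, trace_permAct])
  have hN : (Fintype.card G : ℤ) ≠ 0 := by exact_mod_cast Fintype.card_ne_zero
  apply mul_left_cancel₀ hN
  rw [← hT1, hcomp, hT2]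

end general

/-! ## §2 `GL₂(𝔽_q)`: the convolution supply and SUPPLY by name -/

variable {q : ℕ} [Fact q.Prime]

/-- **CONVOLUTION SUPPLY**: per prime `q ∉ {2, 3}` — (α) `χ_W(1)·Σ_h χ_W(h)χ_W(h⁻¹k) = |G|·χ_W(k)` for all `k`, and (β) `χ_W(1)·Σ_h χ_W(h)·#Fix(gh | G∕T) = |G|·χ_W(g)`
for all `g`, with `T = T_s` (`q ≡ 1 (3)`) resp. `T = C(η)` for some elliptic `η` (`q ≡ 2 (3)`). Finite sums; no representation theory in the statement. [folklore] -/
@[conjecture]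
def CartanConvolutionSupply : Prop := ∀ q : ℕ, ∀ _hq : Fact q.Prime, q ≠ 3 → q ≠ 2 →
  (∀ k : G q, cubicNewvectorChar q 1 * ∑ h : G q, cubicNewvectorChar q h * cubicNewvectorChar q (h⁻¹ * k) =
      Fintype.card (G q) * cubicNewvectorChar q k) ∧
  (q % 3 = 1 → ∀ g : G q, cubicNewvectorChar q 1 * ∑ h : G q, cubicNewvectorChar q h *
      ((Finset.univ.filter fun i : Fin (Nat.card (G q ⧸ splitTorusSub q)) => cosetPerm (splitTorusSub q) (g * h) i = i).card : ℤ) =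
      Fintype.card (G q) * cubicNewvectorChar q g) ∧
  (q % 3 = 2 → ∃ η : Mat q, ¬ HasRatEigenvalue η ∧ ∀ g : G q, cubicNewvectorChar q 1 * ∑ h : G q, cubicNewvectorChar q h *
      ((Finset.univ.filter fun i : Fin (Nat.card (G q ⧸ centralizerSub η)) => cosetPerm (centralizerSub η) (g * h) i = i).card : ℤ) =
      Fintype.card (G q) * cubicNewvectorChar q g)

omit [Fact q.Prime] in
/-- PROVED — **TRACE IDENTITY SUPPLY ⟸ CONVOLUTION SUPPLY**. [folklore] -/
theorem cartanTraceIdentitySupply_of_convolutionSupply (h : CartanConvolutionSupply) : CartanTraceIdentitySupply := by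
  intro q hq h3 hq2
  obtain ⟨hα, hβs, hβc⟩ := h q hq h3 hq2
  refine ⟨fun h1 g => ?_, fun h2 => ?_⟩
  · exact trace_eq_of_convolution (cosetPerm (splitTorusSub q)) (cubicNewvectorChar q) (ker_isotypicOp_stable _) hα (hβs h1) g
  · obtain ⟨η, hη, hβ⟩ := hβc h2
    exact ⟨η, hη, fun g => trace_eq_of_convolution (cosetPerm (centralizerSub η)) (cubicNewvectorChar q) (ker_isotypicOp_stable _) hα hβ g⟩

omit [Fact q.Prime] in
/-- PROVED — **SUPPLY ⟸ CONVOLUTION SUPPLY** (`CartanTorusLatticeSupply`, the v11 stub of line `cartan`, BY NAME). [folklore] -/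
theorem cartanTorusLatticeSupply_of_convolutionSupply (h : CartanConvolutionSupply) : CartanTorusLatticeSupply :=
  cartanTorusLatticeSupply_of_traceIdentitySupply (cartanTraceIdentitySupply_of_convolutionSupply h)

end Summit.BirchSwinnertonDyer.BirchSwinnertonDyer.Theorems.CartanSupply
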